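import Literature.MathematicalPhysics.QuantumFieldTheory.Balaban1983to89.B16Sect1Backgrounds
import Literature.MathematicalPhysics.QuantumFieldTheory.Balaban1983to89.B16Sect1Wilson
import Literature.MathematicalPhysics.QuantumFieldTheory.Balaban1983to89.B16Sect1Assembly
import Literature.MathematicalPhysics.QuantumFieldTheory.Balaban1983to89.B16Sect1Statements

/-!
# `Balaban1983to89.B16Eq133NewDeterminingSet` — T. Bałaban, *Large field renormalization. II. Localization,
exponentiation, and bounds for the 𝐑 operation*, Commun. Math. Phys. **122** (1989) 355–392 [Balaban1989LargeFieldII]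
(cell paper B16; PDF held `paper:balaban1989-cmp122-large-field-ii`, journal page = PDF page + 354), Sect. 1 p. 365
[PDF 11]: the NEW DETERMINING SET `𝐁_k` of **(1.33)**, the new gauge field variables `V` of **(1.34)** and the new
background `U_k = U_{𝐁_k}(V)` of **(1.35)**, WITH THEIR BODIES ON THE DETERMINING-SET CARRIER OF RECORD
(`…B15DeterminingSets`: `DetSet`, `DetSet.restrict`, `atScale`, `pts`, `splice`, `DetBackground`), plus the one-line
dictionary identifying the `𝐂_k` of (1.49) (`B16Sect1Assembly.Ck149`) with the `𝐂_k` of p. 369 (`B16Sect1Statements.Ck369`).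

statement-level skeleton of published theorems with citation tags; proofs where landed; nothing here is a claim about
the Yang–Mills mass gap

WHY (mega-formalization `lit-balaban`, block r13 = the B16 owner, gen 100; READING RULE FOR DEFINITION DISPLAYS of the
cell lead, 2026-08-23, condition (a) *"typed WITH ITS BODY verbatim … on print's carrier … PROVIDED print's own instance is
IDENTIFIED by a kernel theorem with the tree's concrete objects at the place where print consumes the display"*).  Until
now (1.33) and (1.34) were typed only as set / function algebra over ONE abstract index type (`B16Sect1Wilson.detSet133`,
`B16Sect1Wilson.glue134`, r13 gen 1), consumed by nothing, while the data record `B16Sect1Backgrounds.Sect1Data` over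
which (1.35), (1.36), (1.56), (1.58) are typed carries `𝐁_k` as a FREE field `detK`.  Here:

* §1 **(1.33) on the carrier.**  p. 365, verbatim (render `…-p011-x2.png` re-read by this seat, gen 100): *"Now we
  introduce a new determining set 𝐁_k, and a new background field U_k. We define 𝐁_k as equal to 𝐁″_k on Zᶜ, and to
  {Z^{(k)}} on Z. More precisely 𝐁_k = {Γ_j}, where Γ_j = Γ″_j ∩ Zᶜ for j < k, Γ_k = Γ″_k ∪ Z^{(k)}. (1.33)"*.  The
  first sentence IS the body: `detSetK133 𝐁″ Z k := 𝐁″ ∩ Zᶜ ∪ {T^{(k)}} ∩ Z` (`DetSet.restrict`, `atScale k`); the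
  *"More precisely"* clauses are PROVED (`detSetK133_of_lt`, `detSetK133_self` — the latter is the set identity
  `(Γ″_k ∩ Zᶜ) ∪ Z^{(k)} = Γ″_k ∪ Z^{(k)}`); above `k` the set has no members when `𝐁″_k` has none
  (`detSetK133_of_gt`); and scale by scale it IS r13's one-type declaration of record (`detSetK133_eq_detSet133`).
* §2 **(1.34) on the carrier** = the datum `Sect1Data.data134` of `B16Sect1Backgrounds` (`splice Zᶜ V″ (V′_k·V_Λ)`),
  read bond by bond (`data134_of_mem`, `data134_of_not_mem`) and identified with r13's one-type `glue134`
  (`data134_eq_glue134`; the bond predicate "in Z" = "does not meet Zᶜ", the `splice` convention of record).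
* §3 **(1.35) with the body of (1.33)**: the record `with133 D` = `D` with its free field `detK` replaced by
  `detSetK133 D.detPP D.Z D.k`; at this instance the configuration of record `Sect1Data.cfgK135` IS
  `U(𝐁_k, V)` with BOTH arguments carrying their printed bodies (`cfgK135_with133`, `rfl`), and likewise the two later
  consumers of `𝐁_k`, (1.56) `cfgKΛ` and (1.58) `cfgK` (`cfgKΛ_with133`, `cfgK_with133`); the constraint half of
  *"U_k = U_{𝐁_k}(V)"* — `U_k` is the `𝐁_k`-minimizer for the datum `V` — follows from the solution map's defining
  property (`isMinimizer_cfgK135_with133`), and the constraint on `𝐁_k` SPLITS along (1.33) into the `𝐁″_k ∩ Zᶜ` part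
  and the scale-`k` part on `Z^{(k)}` (`agreeOn_detSetK133_iff`).
* §4 the `𝐂_k` dictionary (`Ck149_eq_Ck369`, `rfl`): row B16.Def@369's abstract-family `𝐂_k = I(U₀) + Σ_i t_i` is, for
  the family of created terms read as functions of the integration variable, the `𝐂_k = I(U₀) + small` consumed in the
  PROVED (1.49) (`B16Sect1Assembly.eq149`).

Nothing printed is asserted as a fact: only definitions with bodies and theorems about them; no `sorry`, no new
`def … : Prop`.  Depends on: B16.Eq1.33/1.34/1.35 (this paper), [III] (2.2)/(2.10)–(2.12) [Balaban1988Convergent]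
(`DetSet`, `AgreeOn`, `DetBackground`), [IV] (1.20) [Balaban1989LargeFieldI] (`splice`).
-/

namespace Literature.MathematicalPhysics.QuantumFieldTheory.Balaban1983to89.B16Eq133NewDeterminingSet

open Literature.MathematicalPhysics.QuantumFieldTheory.Balaban1983to89
open B15DeterminingSets B16Sect1Backgrounds Set

variable {P : Params}

/-! ## §1. (1.33): the new determining set `𝐁_k` on the carrier of record -/

/-- **(1.33)** p. 365 [PDF 11], verbatim: *"We define 𝐁_k as equal to 𝐁″_k on Zᶜ, and to {Z^{(k)}} on Z."* — on
`B15DeterminingSets.DetSet`: the scale-wise restriction of `𝐁″ = {Γ″_j}` to `Zᶜ` joined with the one-scale determining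
set `{T^{(k)}}` (`atScale k`) restricted to `Z`. [cite: Balaban1989LargeFieldII, (1.33) p.365] -/
def detSetK133 (ΓPP : DetSet P) (Z : Set (Site P 0)) (k : ℕ) : DetSet P :=
  ΓPP.restrict Zᶜ ∪ (atScale k).restrict Z

/-- (1.33) scale by scale (definitional): `Γ_j = (Γ″_j ∩ (Zᶜ)^{(j)}) ∪ ({T^{(k)}}_j ∩ Z^{(j)})`. [cite: Balaban1989LargeFieldII, (1.33) p.365] -/
theorem detSetK133_apply (ΓPP : DetSet P) (Z : Set (Site P 0)) (k j : ℕ) :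
    detSetK133 ΓPP Z k j = (ΓPP j ∩ pts j Zᶜ) ∪ (atScale k j ∩ pts j Z) := rfl

/-- Off the distinguished scale the second piece of (1.33) is empty: `Γ_j = Γ″_j ∩ Zᶜ` for `j ≠ k`. [cite: Balaban1989LargeFieldII, (1.33) p.365] -/
theorem detSetK133_of_ne (ΓPP : DetSet P) (Z : Set (Site P 0)) {k j : ℕ} (h : j ≠ k) :
    detSetK133 ΓPP Z k j = ΓPP j ∩ (pts j Z)ᶜ := by
  rw [detSetK133_apply]
  simp [atScale, h, (pts_boolean j Z Z).2.2.1]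

/-- **(1.33), the clause `j < k`**, verbatim: *"Γ_j = Γ″_j ∩ Zᶜ for j < k"* (`Zᶜ` read on `T^{(j)}`:
`(Zᶜ)^{(j)} = (Z^{(j)})ᶜ`, `pts_boolean`). [cite: Balaban1989LargeFieldII, (1.33) p.365] -/
theorem detSetK133_of_lt (ΓPP : DetSet P) (Z : Set (Site P 0)) {k j : ℕ} (h : j < k) :
    detSetK133 ΓPP Z k j = ΓPP j ∩ (pts j Z)ᶜ :=
  detSetK133_of_ne ΓPP Z h.ne

/-- **(1.33), the clause `j = k`**, verbatim: *"Γ_k = Γ″_k ∪ Z^{(k)}"* — PROVED from the first sentence: `(Γ″_k ∩ Zᶜ) ∪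
Z^{(k)} = Γ″_k ∪ Z^{(k)}`. [cite: Balaban1989LargeFieldII, (1.33) p.365] -/
theorem detSetK133_self (ΓPP : DetSet P) (Z : Set (Site P 0)) (k : ℕ) :
    detSetK133 ΓPP Z k k = ΓPP k ∪ pts k Z := by
  rw [detSetK133_apply]
  ext y
  simp only [atScale, if_true, univ_inter, mem_union, mem_inter_iff, mem_pts, mem_compl_iff]
  tauto

/-- Above the top scale the new determining set has no members where `𝐁″_k` has none (print: `𝐁_k = {Γ_j}` with
`j ≤ k`). [cite: Balaban1989LargeFieldII, (1.33) p.365] -/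
theorem detSetK133_of_gt (ΓPP : DetSet P) (Z : Set (Site P 0)) {k j : ℕ} (h : k < j) (hΓ : ΓPP j = ∅) :
    detSetK133 ΓPP Z k j = ∅ := by
  rw [detSetK133_of_ne ΓPP Z h.ne', hΓ, empty_inter]

/-- Membership in `𝐁_k` below the top scale: `y ∈ Γ_j ↔ y ∈ Γ″_j ∧ y ∉ Z` (`j < k`). [cite: Balaban1989LargeFieldII, (1.33) p.365] -/
theorem mem_detSetK133_of_lt (ΓPP : DetSet P) (Z : Set (Site P 0)) {k j : ℕ} (h : j < k) (y : Site P j) :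
    y ∈ detSetK133 ΓPP Z k j ↔ y ∈ ΓPP j ∧ embIter j y ∉ Z := by
  rw [detSetK133_of_lt ΓPP Z h]
  rfl

/-- Membership in `𝐁_k` at the top scale: `y ∈ Γ_k ↔ y ∈ Γ″_k ∨ y ∈ Z^{(k)}`. [cite: Balaban1989LargeFieldII, (1.33) p.365] -/
theorem mem_detSetK133_self (ΓPP : DetSet P) (Z : Set (Site P 0)) (k : ℕ) (y : Site P k) :
    y ∈ detSetK133 ΓPP Z k k ↔ y ∈ ΓPP k ∨ embIter k y ∈ Z := by
  rw [detSetK133_self ΓPP Z k]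
  rfl

/-- DICTIONARY with row B16.Eq1.33's one-type declaration of record `B16Sect1Wilson.detSet133` (set algebra over one
ambient index type): at every scale `j ≤ k`, with the ambient type `T^{(j)}` and `Z`, `Z^{(k)}` both read as `Z^{(j)}`,
the two definitions agree. [cite: Balaban1989LargeFieldII, (1.33) p.365] -/
theorem detSetK133_eq_detSet133 (ΓPP : DetSet P) (Z : Set (Site P 0)) {k j : ℕ} (hj : j ≤ k) :
    detSetK133 ΓPP Z k j = B16Sect1Wilson.detSet133 (fun _ => ΓPP j) (pts j Z) (pts j Z) k j := by
  rcases hj.lt_or_eq with h | rfl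
  · rw [detSetK133_of_lt ΓPP Z h, B16Sect1Wilson.detSet133_of_lt _ _ _ h]
  · rw [detSetK133_self, B16Sect1Wilson.detSet133_self]

/-! ### The constraint on `𝐁_k` splits along (1.33) -/

section Agree

variable {G : Type*}

/-- The bonds meeting a union are the bonds meeting either part. [cite: Balaban1987RG1, (0.1) p.251] -/
theorem bondsOf_union {j : ℕ} (S T : Set (Site P j)) : bondsOf (S ∪ T) = bondsOf S ∪ bondsOf T := by
  ext b
  simp only [bondsOf, mem_setOf_eq, mem_union]
  tauto

/-- Agreement of two multi-scale fields on a scale-wise union of determining sets is agreement on each ([III] (2.10)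
read on `𝔹 ∪ 𝔹′`). [cite: Balaban1988Convergent, (2.10) p.256] -/
theorem agreeOn_union_iff (𝔹 𝔹' : DetSet P) (V W : MSField P G) :
    AgreeOn (𝔹 ∪ 𝔹') V W ↔ AgreeOn 𝔹 V W ∧ AgreeOn 𝔹' V W := by
  constructor
  · intro h
    exact ⟨fun j b hb => h j b (by rw [DetSet.union_apply, bondsOf_union]; exact Or.inl hb),
      fun j b hb => h j b (by rw [DetSet.union_apply, bondsOf_union]; exact Or.inr hb)⟩
  · rintro ⟨h, h'⟩ j b hb
    rw [DetSet.union_apply, bondsOf_union] at hb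
    rcases hb with hb | hb
    · exact h j b hb
    · exact h' j b hb

/-- The constraint *"M_{𝐁_k}(U) = V"* on the new determining set SPLITS along (1.33): agreement on `𝐁″_k ∩ Zᶜ` and
agreement on `Z^{(k)}` at scale `k` — the two halves *"equal to 𝐁″_k on Zᶜ, and to {Z^{(k)}} on Z"*. [cite: Balaban1989LargeFieldII, (1.33) p.365] -/
theorem agreeOn_detSetK133_iff (ΓPP : DetSet P) (Z : Set (Site P 0)) (k : ℕ) (V W : MSField P G) :
    AgreeOn (detSetK133 ΓPP Z k) V W ↔
      AgreeOn (ΓPP.restrict Zᶜ) V W ∧ AgreeOn ((atScale k).restrict Z) V W :=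
  agreeOn_union_iff _ _ V W

/-- The scale-`k` half of the constraint in words: on every bond of `T^{(k)}` meeting `Z^{(k)}` the two fields agree
at scale `k` (and the piece says nothing at other scales). [cite: Balaban1989LargeFieldII, (1.33) p.365] -/
theorem agreeOn_atScale_restrict_iff (Z : Set (Site P 0)) (k : ℕ) (V W : MSField P G) :
    AgreeOn ((atScale k).restrict Z) V W ↔ ∀ b ∈ bondsOf (pts k Z), V k b = W k b := by
  constructor
  · intro h b hb
    exact h k b (by simpa [atScale] using hb)
  · intro h j b hb
    by_cases hj : j = k
    · subst hj
      exact h b (by simpa [atScale] using hb)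
    · simp [atScale, hj, bondsOf] at hb

end Agree

/-! ## §2. (1.34): the new gauge field variables `V` on the carrier of record -/

section NewVariables

variable {G : Type*} [GaugeGroup G] {av : ∀ i, Averaging P i G} {𝔤 : Type*} [AddCommGroup 𝔤] [Module ℝ 𝔤]
variable (D : Sect1Data P G av 𝔤)

/-- **(1.34)** p. 365 [PDF 11], verbatim: *"On this determining set we define new gauge field variables V: V↾_{Zᶜ} =
V″↾_{Zᶜ}, V↾_Z = V′_kV_Λ↾_Z. (1.34)"* — the datum of record `Sect1Data.data134 = splice Zᶜ V″ (V′_k·V_Λ)` read bond by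
bond: a bond of `T^{(j)}` MEETING `(Zᶜ)^{(j)}` carries `V″`. [cite: Balaban1989LargeFieldII, (1.34) p.365] -/
theorem data134_of_mem {j : ℕ} {b : PBond P j} (hb : b ∈ bondsOf (pts j D.Zᶜ)) :
    D.data134 j b = D.Vpp j b := by
  classical
  simp only [Sect1Data.data134, splice, spliceAt, hb, if_true]

/-- (1.34), the other half: a bond of `T^{(j)}` NOT meeting `(Zᶜ)^{(j)}` (both end-points in `Z`) carries `V′_k·V_Λ`
(bondwise product). [cite: Balaban1989LargeFieldII, (1.34) p.365] -/
theorem data134_of_not_mem {j : ℕ} {b : PBond P j} (hb : b ∉ bondsOf (pts j D.Zᶜ)) :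
    D.data134 j b = D.Vk' j b * D.VΛ j b := by
  classical
  simp only [Sect1Data.data134, splice, spliceAt, hb, if_false]
  rfl

open Classical in
/-- DICTIONARY with row B16.Eq1.34's one-type declaration of record `B16Sect1Wilson.glue134` (pointwise gluing over an
abstract bond type with a membership predicate *"the bond lies in Z"*): at every scale, with *"lies in Z"* := *"does
not meet Zᶜ"* (the `splice` convention of record), the datum `data134` IS `glue134`. [cite: Balaban1989LargeFieldII, (1.34) p.365] -/
theorem data134_eq_glue134 (j : ℕ) :
    D.data134 j = B16Sect1Wilson.glue134 (fun b => b ∉ bondsOf (pts j D.Zᶜ)) (D.Vpp j) (D.Vk' j) (D.VΛ j) := by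
  funext b
  by_cases hb : b ∈ bondsOf (pts j D.Zᶜ)
  · rw [data134_of_mem D hb]
    simp [B16Sect1Wilson.glue134, hb]
  · rw [data134_of_not_mem D hb]
    simp [B16Sect1Wilson.glue134, hb]

/-! ## §3. (1.35) with the body of (1.33): the instance of record `with133` -/

/-- The new determining set of THE data record: (1.33) applied to its `𝐁″_k` (`detPP`), `Z` and `k`.
[cite: Balaban1989LargeFieldII, (1.33) p.365] -/
def detK133 : DetSet P := detSetK133 D.detPP D.Z D.k

/-- The data record with its free field `𝐁_k` (`detK`) REPLACED by the body of (1.33); every other field unchanged.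
[cite: Balaban1989LargeFieldII, (1.33) p.365] -/
def with133 : Sect1Data P G av 𝔤 := { D with detK := detK133 D }

/-- The `𝐁_k` of `with133 D` is (1.33) (definitional). [cite: Balaban1989LargeFieldII, (1.33) p.365] -/
@[simp] theorem with133_detK : (with133 D).detK = detK133 D := rfl

/-- A record whose `𝐁_k` already is (1.33) is unchanged by `with133`. [cite: Balaban1989LargeFieldII, (1.33) p.365] -/
theorem with133_eq_self (h : D.detK = detK133 D) : with133 D = D := by
  cases D
  simp only [with133, detK133] at h ⊢
  subst h
  rfl

/-- The (1.34) datum is untouched by `with133` (definitional). [cite: Balaban1989LargeFieldII, (1.34) p.365] -/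
@[simp] theorem with133_data134 : (with133 D).data134 = D.data134 := rfl

/-- **(1.35)** p. 365 [PDF 11], verbatim: *"The new background field U_k is defined by U_k = U_{𝐁_k}(V). (1.35)"* — at
the instance of record BOTH arguments carry their printed bodies: `U_k = U(𝐁_k, V)` with `𝐁_k` = (1.33)
(`detSetK133 𝐁″_k Z k`) and `V` = (1.34) (`data134`); `U(𝐁, ·)` = the solution map of [III] (2.12)
(`DetBackground.U`). [cite: Balaban1989LargeFieldII, (1.35) p.365] -/
theorem cfgK135_with133 : (with133 D).cfgK135 = D.bg.U (detSetK133 D.detPP D.Z D.k) D.data134 := rfl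

/-- The later consumer (1.56) `U_{k,Λ} = U_k(V″↾_{Λᶜ}, V_Λ^{(A)})` at the instance of record: `U_k(·) = U(𝐁_k, ·)` with
`𝐁_k` = (1.33). [cite: Balaban1989LargeFieldII, (1.56) p.371] -/
theorem cfgKΛ_with133 :
    (with133 D).cfgKΛ = D.bg.U (detSetK133 D.detPP D.Z D.k) (splice D.Λᶜ D.Vpp D.VΛA) := rfl

/-- The later consumer (1.58) `U_k = U_k(V″↾_{Λᶜ}, V′_kV_Λ^{(A)})` at the instance of record: `𝐁_k` = (1.33).
[cite: Balaban1989LargeFieldII, (1.58) p.371] -/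
theorem cfgK_with133 :
    (with133 D).cfgK = D.bg.U (detSetK133 D.detPP D.Z D.k) (splice D.Λᶜ D.Vpp (msMul D.Vk' D.VΛA)) := rfl

/-- The constraint half of *"U_k = U_{𝐁_k}(V)"*: for a datum in the domain of the solution map, `U_k` is a minimal
configuration of [III] (2.12) for the determining set (1.33) and the datum (1.34) — its averages agree with `V` on
`𝐁_k` and it minimizes the Wilson action in that class (the defining property of `DetBackground`, nothing asserted
beyond it). [cite: Balaban1989LargeFieldII, (1.35) p.365] -/
theorem isMinimizer_cfgK135_with133 (hV : D.data134 ∈ D.bg.dom (detK133 D)) :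
    IsMinimizer av D.bg.reg (detSetK133 D.detPP D.Z D.k) D.data134 (with133 D).cfgK135 :=
  D.bg.isMinimizer _ _ hV

/-- The constraint on `U_k` read through (1.33)–(1.34): off `Z` the averages of `U_k` agree with `V″` on `𝐁″_k ∩ Zᶜ`,
and at scale `k` they agree with `V′_kV_Λ` on the bonds meeting `Z^{(k)}` that do not meet `(Zᶜ)^{(k)}` (on the bonds
meeting both, i.e. crossing `∂Z`, the datum is `V″` by the `splice` convention). [cite: Balaban1989LargeFieldII, (1.35) p.365] -/
theorem agreeOn_cfgK135_with133 (hV : D.data134 ∈ D.bg.dom (detK133 D)) :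
    AgreeOn (D.detPP.restrict D.Zᶜ) (avgFamily av (with133 D).cfgK135) D.Vpp ∧
      ∀ b ∈ bondsOf (pts D.k D.Z), b ∉ bondsOf (pts D.k D.Zᶜ) →
        avgFamily av (with133 D).cfgK135 D.k b = D.Vk' D.k b * D.VΛ D.k b := by
  have h := (isMinimizer_cfgK135_with133 D hV).2.1
  rw [agreeOn_detSetK133_iff] at h
  refine ⟨fun j b hb => ?_, fun b hb hb' => ?_⟩
  · rw [h.1 j b hb]
    have hb' : b ∈ bondsOf (pts j D.Zᶜ) := by
      rw [DetSet.restrict_apply] at hb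
      rcases hb with hb | hb
      · exact Or.inl hb.2
      · exact Or.inr hb.2
    exact data134_of_mem D hb'
  · rw [(agreeOn_atScale_restrict_iff D.Z D.k _ _).1 h.2 b hb]
    exact data134_of_not_mem D hb'

end NewVariables

/-! ## §4. p. 369: the `𝐂_k` of (1.49) is the `𝐂_k` of row B16.Def@369 -/

/-- DICTIONARY, p. 369, verbatim: *"We denote the sum of all these terms, including the term I(U₀) from the denominator, by
𝐂_k."* — for a finite family `t_i` of created terms read as functions of the integration variable `b`, the `𝐂_k = I(U₀)
+ small` consumed by the PROVED (1.49) (`B16Sect1Assembly.Ck149`, `eq149`) with `small b = Σ_i t_i(b)` IS row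
B16.Def@369's `𝐂_k = I(U₀) + Σ_i t_i` (`B16Sect1Statements.Ck369`) evaluated at `b` (definitional). [cite: Balaban1989LargeFieldII, p.369 (before (1.49))] -/
theorem Ck149_eq_Ck369 {Ω : Type*} [MeasurableSpace Ω] {ι : Type*} (s : Finset ι) (t : ι → Ω → ℝ) (I : ℝ) (b : Ω) :
    B16Sect1Assembly.Ck149 I (fun b => ∑ i ∈ s, t i b) b = B16Sect1Statements.Ck369 s (fun i => t i b) I := rfl

/-- Hence the boundedness *"although we need boundedness only"* of row B16.Def@369 (`abs_Ck369_le_of_bounds`) transfers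
verbatim to the `𝐂_k` inside (1.49): `|𝐂_k(b)| ≤ B_I + (#terms)·τ` from `|I(U₀)| ≤ B_I` and `|t_i(b)| ≤ τ`. [cite: Balaban1989LargeFieldII, p.369 (before (1.49))] -/
theorem abs_Ck149_le_of_bounds {Ω : Type*} [MeasurableSpace Ω] {ι : Type*} (s : Finset ι) (t : ι → Ω → ℝ)
    (I τ BI : ℝ) (b : Ω) (hI : |I| ≤ BI) (ht : ∀ i ∈ s, |t i b| ≤ τ) :
    |B16Sect1Assembly.Ck149 I (fun b => ∑ i ∈ s, t i b) b| ≤ BI + s.card * τ := by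
  rw [Ck149_eq_Ck369]
  exact B16Sect1Statements.abs_Ck369_le_of_bounds s _ I τ BI hI ht

end Literature.MathematicalPhysics.QuantumFieldTheory.Balaban1983to89.B16Eq133NewDeterminingSet
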